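import Summits.BirchSwinnertonDyer.BirchSwinnertonDyer.Theorems.TwoAdicConverseOffHabitatStrataLeaf
import Summits.BirchSwinnertonDyer.BirchSwinnertonDyer.Theses.KolyvaginRankRigidityAtTwo
import Summits.BirchSwinnertonDyer.BirchSwinnertonDyer.Theorems.KolyvaginRankRigidityAtTwoClosesRevThirteen
import HarnessLib

/-!
# Routes TwoAdicConverse / KolyvaginRankRigidityAtTwo — the off-habitat residual 24303 and its
# pieces, BY NAME on both routes (kernel glue for KRR2 memo v3 ADDENDUM B (B1)/(B2); proofs only)

Cell `bsd-2adic`, seat `bsd-2adic-conv-1` GEN 18 (`--supports` item stmt-BirchSwinnertonDyer-19218; nothing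
here closes an item).  Planner RC-209 recorded, for the KRR2 tenure / operator: (B1) SPLIT KRR2's residual
item 24303 `KolyvaginRankRigidityAtTwo.OffHabitatNonSurjTwoConverse` (off the surjective-`2`-adic-image
habitat, `r ≤ 1`: non-CM, good-ordinary or multiplicative at `2`, `corank₂ = r ⟹ r_an = r`) into
`R0OffBigImageGoodOrd` · `R0OffBigImageMult` · S3's item 24404
`TwoAdicConverse.RankOneTwoConverseOffBigImage` with trivial glue; (B2) attach S3's ∀-items 19218/19219 as
a-fortiori lines of those pieces.  This file certifies the glue in the kernel, BY NAME on both route files: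

* `offHabitatNonSurjTwoConverse_iff_pieces` — 24303 ⟺ (R0 good-ord piece) ∧ (R0 mult piece) ∧ 24404;
  `offHabitatNonSurjTwoConverse_of_pieces` is the (B1) glue, `rankOneTwoConverseOffBigImage_of_offHabitat…`
  etc. the projections;
* `offHabitatNonSurjTwoConverse_of_three_strata` — the good-ordinary `r = 0` piece further split into the
  THREE strata of `TwoAdicConverseOffHabitatStrata` §4 ((β) rational `2`-torsion, (γ₁) `C₃` image,
  (γ₂) `ℚ(√Δ) = ℚ(i)`; (γ₃)/(γ₄) empty at a good ordinary `2`), and `offHabitatNonSurjTwoConverse_of_strata`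
  — 24303 from the four LEVEL-stratum pieces of the leaf;
* (B2) `goodOrdinaryRankZeroTwoConverse_of_kolyvaginAtTwo_of_offHabitatNonSurjTwoConverse` — S3's item
  19218 BY NAME from KRR2's cruxes 24622 V1′ + 24623 V2♭ + 24405 + PUB + KRR2's residual 24303 (so 19218 is
  IN-CONE for KRR2's items), and the 19219 / leaf twins.

HONEST FRAMING.  Pure logic: the pieces, 24303, 24404, V1′, V2♭ are OPEN hypotheses; PRINT inputs are the
tree's named facts taken as hypotheses; no item is filed (D-0014), nothing is booked (D-0054); BSD is not
proved by any of this.  PARTITION: none — RANK axis (S3); the off-habitat complement of X5@2 good-ord/mult.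

References: W. Zhang, Camb. J. Math. 2 (2014) Thm 1.1 [WZhang2014]; J. Rouse, D. Zureick-Brown, Res. Number
Theory 1 (2015) [RouseZureickbrown2015]; T. Dokchitser, V. Dokchitser, Math. Z. 272 (2012) [DokchitserDokchitserMathZ2012].
-/

set_option autoImplicit false
-- the Theorems namespace of this sub repeats the summit name by design (D-0017 nested layout)
set_option linter.dupNamespace false

namespace Summit.BirchSwinnertonDyer.BirchSwinnertonDyer.Theorems.TwoAdicOffHabitat

open Literature Literature.NumberTheory.EllipticCurves Literature.NumberTheory.EllipticCurves.ModularForms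
  Literature.NumberTheory.EllipticCurves.Rank1Residual
  Summit.BirchSwinnertonDyer.BirchSwinnertonDyer.Theses
  Summit.BirchSwinnertonDyer.BirchSwinnertonDyer.Theses.TwoAdicConverse
  Summit.BirchSwinnertonDyer.BirchSwinnertonDyer.Theorems.TwoAdicKolyvaginRankZero

/-! ## §1 KRR2's residual 24303 ⟺ its three (B1) pieces -/

/-- **(B1) glue: KRR2's residual 24303 `OffHabitatNonSurjTwoConverse` from its three pieces** — the
`r = 0` good-ordinary piece (`R0OffBigImageGoodOrd`, verbatim the `hOff` binder of p607060 §4), the `r = 0`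
multiplicative piece (`R0OffBigImageMult`) and S3's item 24404 `RankOneTwoConverseOffBigImage` (`r = 1`),
BY NAME. [cite: RouseZureickbrown2015, §1 (the 1208 2-adic images)] [cite: WZhang2014, Thm. 1.1 (shape)] -/
theorem offHabitatNonSurjTwoConverse_of_pieces
    (hGo : ∀ (W : WeierstrassCurve ℚ) [W.IsElliptic] [W.IsGloballyMinimal], ¬ W.HasCM → GoodOrd W 2 →
      ¬ (∀ m : ℕ, W.HasSurjectiveModNGaloisRep (2 ^ m : ℕ)) → W.selmerCorank 2 = 0 → W.analyticRank = 0)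
    (hMu : ∀ (W : WeierstrassCurve ℚ) [W.IsElliptic] [W.IsGloballyMinimal], ¬ W.HasCM → Mult W 2 →
      ¬ (∀ m : ℕ, W.HasSurjectiveModNGaloisRep (2 ^ m : ℕ)) → W.selmerCorank 2 = 0 → W.analyticRank = 0)
    (h1 : TwoAdicConverse.RankOneTwoConverseOffBigImage) :
    KolyvaginRankRigidityAtTwo.OffHabitatNonSurjTwoConverse := by
  unfold TwoAdicConverse.RankOneTwoConverseOffBigImage at h1
  intro W _ _ hCM hred r hr hc hoff
  rcases Nat.le_one_iff_eq_zero_or_eq_one.mp hr with rfl | rfl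
  · rcases hred with hgo | hm
    · exact hGo W hCM hgo hoff hc
    · exact hMu W hCM hm hoff hc
  · exact h1 W hCM hred hoff hc

/-- **24303 ⟹ the `r = 0` good-ordinary piece** (a-fortiori projection). [cite: WZhang2014, Thm. 1.1 (shape)] -/
theorem goodOrd_rankZero_offBigImage_of_offHabitatNonSurjTwoConverse
    (hR : KolyvaginRankRigidityAtTwo.OffHabitatNonSurjTwoConverse) :
    ∀ (W : WeierstrassCurve ℚ) [W.IsElliptic] [W.IsGloballyMinimal], ¬ W.HasCM → GoodOrd W 2 →
      ¬ (∀ m : ℕ, W.HasSurjectiveModNGaloisRep (2 ^ m : ℕ)) → W.selmerCorank 2 = 0 → W.analyticRank = 0 :=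
  fun W _ _ hCM hgo hoff hc ↦ hR W hCM (Or.inl hgo) 0 (by omega) hc hoff

/-- **24303 ⟹ the `r = 0` multiplicative piece** (a-fortiori projection). [cite: WZhang2014, Thm. 1.1 (shape)] -/
theorem mult_rankZero_offBigImage_of_offHabitatNonSurjTwoConverse
    (hR : KolyvaginRankRigidityAtTwo.OffHabitatNonSurjTwoConverse) :
    ∀ (W : WeierstrassCurve ℚ) [W.IsElliptic] [W.IsGloballyMinimal], ¬ W.HasCM → Mult W 2 →
      ¬ (∀ m : ℕ, W.HasSurjectiveModNGaloisRep (2 ^ m : ℕ)) → W.selmerCorank 2 = 0 → W.analyticRank = 0 :=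
  fun W _ _ hCM hm hoff hc ↦ hR W hCM (Or.inr hm) 0 (by omega) hc hoff

/-- **24303 ⟹ S3's item 24404 `RankOneTwoConverseOffBigImage`** BY NAME (a-fortiori projection, `r = 1`).
[cite: WZhang2014, Thm. 1.1 (shape)] -/
theorem rankOneTwoConverseOffBigImage_of_offHabitatNonSurjTwoConverse
    (hR : KolyvaginRankRigidityAtTwo.OffHabitatNonSurjTwoConverse) :
    TwoAdicConverse.RankOneTwoConverseOffBigImage := by
  unfold TwoAdicConverse.RankOneTwoConverseOffBigImage
  intro W _ _ hCM hred hoff hc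
  exact hR W hCM hred 1 le_rfl hc hoff

/-- **24303 ⟺ its three (B1) pieces** (the split is lossless). [cite: RouseZureickbrown2015, §1] [cite: WZhang2014, Thm. 1.1 (shape)] -/
theorem offHabitatNonSurjTwoConverse_iff_pieces :
    KolyvaginRankRigidityAtTwo.OffHabitatNonSurjTwoConverse ↔
      (∀ (W : WeierstrassCurve ℚ) [W.IsElliptic] [W.IsGloballyMinimal], ¬ W.HasCM → GoodOrd W 2 →
        ¬ (∀ m : ℕ, W.HasSurjectiveModNGaloisRep (2 ^ m : ℕ)) → W.selmerCorank 2 = 0 → W.analyticRank = 0) ∧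
      (∀ (W : WeierstrassCurve ℚ) [W.IsElliptic] [W.IsGloballyMinimal], ¬ W.HasCM → Mult W 2 →
        ¬ (∀ m : ℕ, W.HasSurjectiveModNGaloisRep (2 ^ m : ℕ)) → W.selmerCorank 2 = 0 → W.analyticRank = 0) ∧
      TwoAdicConverse.RankOneTwoConverseOffBigImage :=
  ⟨fun hR ↦ ⟨goodOrd_rankZero_offBigImage_of_offHabitatNonSurjTwoConverse hR,
      mult_rankZero_offBigImage_of_offHabitatNonSurjTwoConverse hR,
      rankOneTwoConverseOffBigImage_of_offHabitatNonSurjTwoConverse hR⟩,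
    fun ⟨hGo, hMu, h1⟩ ↦ offHabitatNonSurjTwoConverse_of_pieces hGo hMu h1⟩

/-! ## §2 24303 from the strata -/

/-- **24303 from THREE good-ordinary strata + the multiplicative `r = 0` piece + 24404**: the good-ordinary
`r = 0` piece is the union of (β) rational `2`-torsion, (γ₁) no `2`-torsion ∧ `Δ ∈ ℚ^{×2}`, (γ₂) `ρ̄₂`
onto ∧ `-Δ ∈ ℚ^{×2}` (`goodOrd_offBigImage_rankZero_of_three_strata`: the Dokchitser–Dokchitser families
`j = -4t³(t + 8)` and `±2Δ ∈ ℚ^{×2}` are empty at a good ordinary `2`).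
[cite: DokchitserDokchitserMathZ2012, Theorem (1)–(3) and Lemma] [cite: WZhang2014, Thm. 1.1 (shape)] -/
theorem offHabitatNonSurjTwoConverse_of_three_strata
    (hβ : ∀ (W : WeierstrassCurve ℚ) [W.IsElliptic] [W.IsGloballyMinimal], ¬ W.HasCM → GoodOrd W 2 →
      (∃ P : W.toAffine.Point, P ≠ 0 ∧ 2 • P = 0) → W.selmerCorank 2 = 0 → W.analyticRank = 0)
    (hγ₁ : ∀ (W : WeierstrassCurve ℚ) [W.IsElliptic] [W.IsGloballyMinimal], ¬ W.HasCM → GoodOrd W 2 →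
      (∀ P : W.toAffine.Point, 2 • P = 0 → P = 0) → IsSquare W.Δ →
      W.selmerCorank 2 = 0 → W.analyticRank = 0)
    (hγ₂ : ∀ (W : WeierstrassCurve ℚ) [W.IsElliptic] [W.IsGloballyMinimal], ¬ W.HasCM → GoodOrd W 2 →
      W.HasSurjectiveModNGaloisRep 2 → IsSquare (-W.Δ) →
      W.selmerCorank 2 = 0 → W.analyticRank = 0)
    (hMu : ∀ (W : WeierstrassCurve ℚ) [W.IsElliptic] [W.IsGloballyMinimal], ¬ W.HasCM → Mult W 2 →
      ¬ (∀ m : ℕ, W.HasSurjectiveModNGaloisRep (2 ^ m : ℕ)) → W.selmerCorank 2 = 0 → W.analyticRank = 0)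
    (h1 : TwoAdicConverse.RankOneTwoConverseOffBigImage) :
    KolyvaginRankRigidityAtTwo.OffHabitatNonSurjTwoConverse :=
  offHabitatNonSurjTwoConverse_of_pieces (goodOrd_offBigImage_rankZero_of_three_strata hβ hγ₁ hγ₂) hMu h1

/-- **24303 from the four LEVEL-stratum pieces of the leaf** (`leaf_offBigImage_of_strata`: (S2t) rational
`2`-torsion, (S2c) `C₃` image, (S4) onto mod `2` not mod `4`, (S8) onto mod `4` not mod `8`; each piece
for `r ≤ 1` and good-ordinary-or-multiplicative at `2`). [cite: DokchitserDokchitserMathZ2012, Theorem (1)–(3)]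
[cite: WZhang2014, Thm. 1.1 (shape)] -/
theorem offHabitatNonSurjTwoConverse_of_strata
    (h2t : ∀ (W : WeierstrassCurve ℚ) [W.IsElliptic] [W.IsGloballyMinimal], ¬ W.HasCM →
      (GoodOrd W 2 ∨ Mult W 2) → (∃ P : W.toAffine.Point, P ≠ 0 ∧ 2 • P = 0) →
      ∀ r : ℕ, r ≤ 1 → W.selmerCorank 2 = r → W.analyticRank = r)
    (h2c : ∀ (W : WeierstrassCurve ℚ) [W.IsElliptic] [W.IsGloballyMinimal], ¬ W.HasCM →
      (GoodOrd W 2 ∨ Mult W 2) → (∀ P : W.toAffine.Point, 2 • P = 0 → P = 0) →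
      ¬ W.HasSurjectiveModNGaloisRep 2 → ∀ r : ℕ, r ≤ 1 → W.selmerCorank 2 = r → W.analyticRank = r)
    (h4 : ∀ (W : WeierstrassCurve ℚ) [W.IsElliptic] [W.IsGloballyMinimal], ¬ W.HasCM →
      (GoodOrd W 2 ∨ Mult W 2) → W.HasSurjectiveModNGaloisRep 2 → ¬ W.HasSurjectiveModNGaloisRep 4 →
      ∀ r : ℕ, r ≤ 1 → W.selmerCorank 2 = r → W.analyticRank = r)
    (h8 : ∀ (W : WeierstrassCurve ℚ) [W.IsElliptic] [W.IsGloballyMinimal], ¬ W.HasCM →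
      (GoodOrd W 2 ∨ Mult W 2) → W.HasSurjectiveModNGaloisRep 4 → ¬ W.HasSurjectiveModNGaloisRep 8 →
      ∀ r : ℕ, r ≤ 1 → W.selmerCorank 2 = r → W.analyticRank = r) :
    KolyvaginRankRigidityAtTwo.OffHabitatNonSurjTwoConverse := by
  intro W _ _ hCM hred r hr hc hoff
  exact leaf_offBigImage_of_strata h2t h2c h4 h8 W hCM hred hoff r hr hc

/-! ## §3 (B2): S3's ∀-items are a-fortiori lines of KRR2's cone -/

/-- **(B2) S3's item 19218 `GoodOrdinaryRankZeroTwoConverse` BY NAME from KRR2's cruxes 24622 V1′ + 24623 V2♭,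
24405, PRINT, and KRR2's residual 24303** (p607060 §4 with `hOff` := the good-ordinary projection of
24303): after this theorem 19218 is in-cone for route KolyvaginRankRigidityAtTwo's items.
[cite: WZhang2014, Thm. 1.1 (shape at p ≥ 5)] [cite: RouseZureickbrown2015, §1] -/
theorem goodOrdinaryRankZeroTwoConverse_of_kolyvaginAtTwo_of_offHabitatNonSurjTwoConverse
    (hV1 : KolyvaginNonvanishingAtTwoFrame) (hV2 : KolyvaginCorankLowerBoundAtTwo)
    (hT : NoTwoTorsionOverK)
    (hmod : exists_isNewformOf)
    (hBFH : bumpFriedbergHoffstein_exists_heegnerField_split_twist_simpleZero)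
    (hpar : ∀ (V : WeierstrassCurve ℚ) [V.IsElliptic], p_parity V 2)
    (hGZK : rank_eq_analyticRank_of_analyticRank_le_one)
    (hE : WeierstrassCurve.hasEntireLFunction_rat)
    (hGZ : ∀ (V : WeierstrassCurve ℚ) (N : ℕ) [NeZero N] (K : Type) [Field K] [NumberField K],
      analyticRankEK_eq_one_iff_heegner_nonTorsion V N K)
    (hrec : ∀ (N : ℕ) [NeZero N] (V : WeierstrassCurve ℚ) (K : Type) [Field K] [NumberField K],
      heegnerPointOfConductor_one_galoisConj N V K)
    (hR : KolyvaginRankRigidityAtTwo.OffHabitatNonSurjTwoConverse) :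
    Summit.BirchSwinnertonDyer.BirchSwinnertonDyer.Theses.TwoAdicConverse.GoodOrdinaryRankZeroTwoConverse :=
  goodOrdinaryRankZeroTwoConverse_of_kolyvaginAtTwo_of_offBigImage hV1 hV2 hT hmod hBFH hpar hGZK hE hGZ hrec
    (goodOrd_rankZero_offBigImage_of_offHabitatNonSurjTwoConverse hR)

/-- **(B2) S3's item 19219 `MultiplicativeRankZeroTwoConverse` BY NAME from 24622 + 24623 + 24405 + PRINT +
24303.** [cite: WZhang2014, Thm. 1.1 (shape at p ≥ 5)] [cite: RouseZureickbrown2015, §1] -/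
theorem multiplicativeRankZeroTwoConverse_of_kolyvaginAtTwo_of_offHabitatNonSurjTwoConverse
    (hV1 : KolyvaginNonvanishingAtTwoFrame) (hV2 : KolyvaginCorankLowerBoundAtTwo)
    (hT : NoTwoTorsionOverK)
    (hmod : exists_isNewformOf)
    (hBFH : bumpFriedbergHoffstein_exists_heegnerField_split_twist_simpleZero)
    (hpar : ∀ (V : WeierstrassCurve ℚ) [V.IsElliptic], p_parity V 2)
    (hGZK : rank_eq_analyticRank_of_analyticRank_le_one)
    (hE : WeierstrassCurve.hasEntireLFunction_rat)
    (hGZ : ∀ (V : WeierstrassCurve ℚ) (N : ℕ) [NeZero N] (K : Type) [Field K] [NumberField K],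
      analyticRankEK_eq_one_iff_heegner_nonTorsion V N K)
    (hrec : ∀ (N : ℕ) [NeZero N] (V : WeierstrassCurve ℚ) (K : Type) [Field K] [NumberField K],
      heegnerPointOfConductor_one_galoisConj N V K)
    (hR : KolyvaginRankRigidityAtTwo.OffHabitatNonSurjTwoConverse) :
    Summit.BirchSwinnertonDyer.BirchSwinnertonDyer.Theses.TwoAdicConverse.MultiplicativeRankZeroTwoConverse :=
  multiplicativeRankZeroTwoConverse_of_kolyvaginAtTwo_of_offBigImage hV1 hV2 hT hmod hBFH hpar hGZK hE hGZ
    hrec (mult_rankZero_offBigImage_of_offHabitatNonSurjTwoConverse hR)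

/-- **The rung leaf from 24622 + 24623 + 24405 + 23951 + BFH + GZK + 24303** (p607060's
`nonCMTwoConverse_of_kolyvaginAtTwo_of_offBigImage` with its off-habitat binder := KRR2's 24303 BY NAME,
hypotheses re-ordered) — the shape of KRR2's own `closes`, re-derived on the S3 side.
[cite: WZhang2014, Thm. 1.1 (shape at p ≥ 5)] -/
theorem nonCMTwoConverse_of_kolyvaginAtTwo_of_offHabitatNonSurjTwoConverse
    (hV1 : KolyvaginNonvanishingAtTwoFrame) (hV2 : KolyvaginCorankLowerBoundAtTwo)
    (hT : NoTwoTorsionOverK) (hIn : TwoAdicConverse.PrintedInputsRankOneAtTwo)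
    (hBFH : bumpFriedbergHoffstein_exists_heegnerField_split_twist_simpleZero)
    (hGZK : rank_eq_analyticRank_of_analyticRank_le_one)
    (hR : KolyvaginRankRigidityAtTwo.OffHabitatNonSurjTwoConverse) :
    Summit.BirchSwinnertonDyer.BirchSwinnertonDyer.Rank1Residual.NonCMTwoConverse :=
  nonCMTwoConverse_of_kolyvaginAtTwo_of_offBigImage hV1 hV2 hT hIn hBFH hGZK
    (fun W _ _ hCM hred hoff r hr hc ↦ hR W hCM hred r hr hc hoff)

/-! ## §4 24303 from `r ≤ 1` pieces: three good-ordinary strata and the multiplicative complement -/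

/-- **KRR2's residual 24303 from FOUR `r ≤ 1` pieces** — the three good-ordinary strata (β) rational
`2`-torsion, (γ₁) no `2`-torsion ∧ `Δ ∈ ℚ^{×2}`, (γ₂) `ρ̄₂` onto ∧ `-Δ ∈ ℚ^{×2}` (each for `r ≤ 1`; the
families `j = -4t³(t + 8)` and `±2Δ ∈ ℚ^{×2}` being empty at a good ordinary `2`,
`offHabitat_elim_of_goodOrd_two`), and the multiplicative-at-`2` off-habitat piece (`r ≤ 1`).  This is
the finest typed split of 24303 the tree currently certifies on the good-ordinary side.
[cite: DokchitserDokchitserMathZ2012, Theorem (1)–(3) and Lemma] [cite: WZhang2014, Thm. 1.1 (shape)] -/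
theorem offHabitatNonSurjTwoConverse_of_goodOrd_three_strata_of_mult
    (hβ : ∀ (W : WeierstrassCurve ℚ) [W.IsElliptic] [W.IsGloballyMinimal], ¬ W.HasCM → GoodOrd W 2 →
      (∃ P : W.toAffine.Point, P ≠ 0 ∧ 2 • P = 0) →
      ∀ r : ℕ, r ≤ 1 → W.selmerCorank 2 = r → W.analyticRank = r)
    (hγ₁ : ∀ (W : WeierstrassCurve ℚ) [W.IsElliptic] [W.IsGloballyMinimal], ¬ W.HasCM → GoodOrd W 2 →
      (∀ P : W.toAffine.Point, 2 • P = 0 → P = 0) → IsSquare W.Δ →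
      ∀ r : ℕ, r ≤ 1 → W.selmerCorank 2 = r → W.analyticRank = r)
    (hγ₂ : ∀ (W : WeierstrassCurve ℚ) [W.IsElliptic] [W.IsGloballyMinimal], ¬ W.HasCM → GoodOrd W 2 →
      W.HasSurjectiveModNGaloisRep 2 → IsSquare (-W.Δ) →
      ∀ r : ℕ, r ≤ 1 → W.selmerCorank 2 = r → W.analyticRank = r)
    (hMu : ∀ (W : WeierstrassCurve ℚ) [W.IsElliptic] [W.IsGloballyMinimal], ¬ W.HasCM → Mult W 2 →
      ¬ (∀ m : ℕ, W.HasSurjectiveModNGaloisRep (2 ^ m : ℕ)) →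
      ∀ r : ℕ, r ≤ 1 → W.selmerCorank 2 = r → W.analyticRank = r) :
    KolyvaginRankRigidityAtTwo.OffHabitatNonSurjTwoConverse := by
  intro W _ _ hCM hred r hr hc hoff
  rcases hred with hgo | hm
  · exact offHabitat_elim_of_goodOrd_two W hgo hoff (fun h ↦ hβ W hCM hgo h r hr hc)
      (fun h h' ↦ hγ₁ W hCM hgo h h' r hr hc) (fun h h' ↦ hγ₂ W hCM hgo h h' r hr hc)
  · exact hMu W hCM hm hoff r hr hc

/-- **Conversely, 24303 gives each of the four `r ≤ 1` pieces** (a-fortiori projections), so the split of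
the previous theorem is lossless. [cite: WZhang2014, Thm. 1.1 (shape)] -/
theorem goodOrd_three_strata_and_mult_of_offHabitatNonSurjTwoConverse
    (hR : KolyvaginRankRigidityAtTwo.OffHabitatNonSurjTwoConverse) :
    (∀ (W : WeierstrassCurve ℚ) [W.IsElliptic] [W.IsGloballyMinimal], ¬ W.HasCM → GoodOrd W 2 →
      (∃ P : W.toAffine.Point, P ≠ 0 ∧ 2 • P = 0) →
      ∀ r : ℕ, r ≤ 1 → W.selmerCorank 2 = r → W.analyticRank = r) ∧
    (∀ (W : WeierstrassCurve ℚ) [W.IsElliptic] [W.IsGloballyMinimal], ¬ W.HasCM → GoodOrd W 2 →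
      (∀ P : W.toAffine.Point, 2 • P = 0 → P = 0) → IsSquare W.Δ →
      ∀ r : ℕ, r ≤ 1 → W.selmerCorank 2 = r → W.analyticRank = r) ∧
    (∀ (W : WeierstrassCurve ℚ) [W.IsElliptic] [W.IsGloballyMinimal], ¬ W.HasCM → GoodOrd W 2 →
      W.HasSurjectiveModNGaloisRep 2 → IsSquare (-W.Δ) →
      ∀ r : ℕ, r ≤ 1 → W.selmerCorank 2 = r → W.analyticRank = r) ∧
    (∀ (W : WeierstrassCurve ℚ) [W.IsElliptic] [W.IsGloballyMinimal], ¬ W.HasCM → Mult W 2 →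
      ¬ (∀ m : ℕ, W.HasSurjectiveModNGaloisRep (2 ^ m : ℕ)) →
      ∀ r : ℕ, r ≤ 1 → W.selmerCorank 2 = r → W.analyticRank = r) := by
  refine ⟨fun W _ _ hCM hgo h2 r hr hc ↦ hR W hCM (Or.inl hgo) r hr hc ?_,
    fun W _ _ hCM hgo hno hsq r hr hc ↦ hR W hCM (Or.inl hgo) r hr hc ?_,
    fun W _ _ hCM hgo hs2 hsq r hr hc ↦ hR W hCM (Or.inl hgo) r hr hc ?_,
    fun W _ _ hCM hm hoff r hr hc ↦ hR W hCM (Or.inr hm) r hr hc hoff⟩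
  · -- a rational `2`-torsion point: `ρ̄₂` is not onto
    intro hsur
    obtain ⟨P, hP0, h2P⟩ := h2
    have h2s : W.HasSurjectiveModNGaloisRep 2 := by simpa using hsur 1
    exact hP0 (((hasSurjectiveModNGaloisRep_two_iff W).mp h2s).1 P h2P)
  · -- `Δ` a square: `ρ̄₂` is not onto
    intro hsur
    have h2s : W.HasSurjectiveModNGaloisRep 2 := by simpa using hsur 1
    exact ((hasSurjectiveModNGaloisRep_two_iff W).mp h2s).2 hsq
  · -- `-Δ` a square: `ρ̄₄` is not onto
    intro hsur
    have h4s : W.HasSurjectiveModNGaloisRep 4 := by simpa using hsur 2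
    exact ((DokchitserDokchitser2012.hasSurjectiveModNGaloisRep_four_iff W).mp h4s).2.1 hsq

/-! ## §5 S3's ∀-items from KRR2 rev 13's item list (margin pair V1′ₛ 27014 / V2♭ₘ 27015), via KRR2's `closes` -/

/-- **The leaf gives S3's item 19218** (a fortiori: `r = 0`, good ordinary). [cite: arXiv250317619, Thm. 1.1 (the p-converse input at p = 2)] -/
theorem goodOrdinaryRankZeroTwoConverse_of_nonCMTwoConverse
    (h : Summit.BirchSwinnertonDyer.BirchSwinnertonDyer.Rank1Residual.NonCMTwoConverse) :
    Summit.BirchSwinnertonDyer.BirchSwinnertonDyer.Theses.TwoAdicConverse.GoodOrdinaryRankZeroTwoConverse := by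
  unfold TwoAdicConverse.GoodOrdinaryRankZeroTwoConverse
  intro W _ _ hCM hgo hc
  exact h W hCM (Or.inl hgo) 0 (by omega) hc

/-- **The leaf gives S3's item 19219** (a fortiori: `r = 0`, multiplicative). [cite: arXiv250317619, Thm. 1.1 (the p-converse input at p = 2)] -/
theorem multiplicativeRankZeroTwoConverse_of_nonCMTwoConverse
    (h : Summit.BirchSwinnertonDyer.BirchSwinnertonDyer.Rank1Residual.NonCMTwoConverse) :
    Summit.BirchSwinnertonDyer.BirchSwinnertonDyer.Theses.TwoAdicConverse.MultiplicativeRankZeroTwoConverse := by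
  unfold TwoAdicConverse.MultiplicativeRankZeroTwoConverse
  intro W _ _ hCM hm hc
  exact h W hCM (Or.inr hm) 0 (by omega) hc

/-- **The leaf gives S3's residual 19220** (a fortiori: `r = 1`). [cite: arXiv250317619, Thm. 1.1 (the p-converse input at p = 2)] -/
theorem rankOneTwoConverse_of_nonCMTwoConverse
    (h : Summit.BirchSwinnertonDyer.BirchSwinnertonDyer.Rank1Residual.NonCMTwoConverse) :
    Summit.BirchSwinnertonDyer.BirchSwinnertonDyer.Theses.TwoAdicConverse.RankOneTwoConverse := by
  unfold TwoAdicConverse.RankOneTwoConverse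
  intro W _ _ hCM hred hc
  exact h W hCM hred 1 le_rfl hc

/-- **(B2) in its strongest form: S3's item 19218 `GoodOrdinaryRankZeroTwoConverse` from route
KolyvaginRankRigidityAtTwo's rev-13 item list BY NAME** — the margin pair V1′ₛ (27014) / V2♭ₘ (27015),
the residual 24303, and KRR2's PRINT items — through KRR2's own deciding theorem `closes` and the
a-fortiori projection of the leaf.  Robust to the planned S3 mirror of the margin forms (RC-211 (2)).
[cite: Kolyvagin1991MathAnn, §2] [cite: WZhang2014, Thm. 1.1 (shape at p ≥ 5)] -/
theorem goodOrdinaryRankZeroTwoConverse_of_kolyvaginRankRigidityAtTwo_items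
    (hV1 : KolyvaginRankRigidityAtTwo.KolyvaginNonvanishingAtTwoFrameStrong)
    (hV2 : KolyvaginRankRigidityAtTwo.KolyvaginCorankLowerBoundAtTwoMargin)
    (hR : KolyvaginRankRigidityAtTwo.OffHabitatNonSurjTwoConverse)
    (hIn : KolyvaginRankRigidityAtTwo.PrintedInputsRankOneAtTwo)
    (hT : KolyvaginRankRigidityAtTwo.NoTwoTorsionOverK)
    (hf : KolyvaginRankRigidityAtTwo.BFHTwistSupply)
    (h0 : KolyvaginRankRigidityAtTwo.SimpleZeroTwistSplitAtTwoOfBFH)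
    (hGZK : KolyvaginRankRigidityAtTwo.MultPublishedInputsAtTwo)
    (hMod : KolyvaginRankRigidityAtTwo.NewformOfEllipticCurve)
    (hHLT : KolyvaginRankRigidityAtTwo.HoffsteinLuoNonvanishingTwist)
    (hEnt : KolyvaginRankRigidityAtTwo.EntireLFunctionRat) :
    Summit.BirchSwinnertonDyer.BirchSwinnertonDyer.Theses.TwoAdicConverse.GoodOrdinaryRankZeroTwoConverse :=
  goodOrdinaryRankZeroTwoConverse_of_nonCMTwoConverse
    -- (buildfix 2026-08-28) KRR2's `closes` was re-keyed (rev 14, R4-θ) to the Theta pair; this accepted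
    -- statement keeps the rev-13 margin pair, so the rev-13 chain (tree theorem) is applied instead.
    (KolyvaginRankRigidity.kolyvaginRankRigidityAtTwo_closes_rev13 hV1 hV2 hR hIn hT hf h0 hGZK hMod hHLT hEnt)

/-- **S3's item 19219 from KRR2's rev-13 item list BY NAME** (same composition).
[cite: Kolyvagin1991MathAnn, §2] [cite: WZhang2014, Thm. 1.1 (shape at p ≥ 5)] -/
theorem multiplicativeRankZeroTwoConverse_of_kolyvaginRankRigidityAtTwo_items
    (hV1 : KolyvaginRankRigidityAtTwo.KolyvaginNonvanishingAtTwoFrameStrong)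
    (hV2 : KolyvaginRankRigidityAtTwo.KolyvaginCorankLowerBoundAtTwoMargin)
    (hR : KolyvaginRankRigidityAtTwo.OffHabitatNonSurjTwoConverse)
    (hIn : KolyvaginRankRigidityAtTwo.PrintedInputsRankOneAtTwo)
    (hT : KolyvaginRankRigidityAtTwo.NoTwoTorsionOverK)
    (hf : KolyvaginRankRigidityAtTwo.BFHTwistSupply)
    (h0 : KolyvaginRankRigidityAtTwo.SimpleZeroTwistSplitAtTwoOfBFH)
    (hGZK : KolyvaginRankRigidityAtTwo.MultPublishedInputsAtTwo)
    (hMod : KolyvaginRankRigidityAtTwo.NewformOfEllipticCurve)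
    (hHLT : KolyvaginRankRigidityAtTwo.HoffsteinLuoNonvanishingTwist)
    (hEnt : KolyvaginRankRigidityAtTwo.EntireLFunctionRat) :
    Summit.BirchSwinnertonDyer.BirchSwinnertonDyer.Theses.TwoAdicConverse.MultiplicativeRankZeroTwoConverse :=
  multiplicativeRankZeroTwoConverse_of_nonCMTwoConverse
    -- (buildfix 2026-08-28) KRR2's `closes` was re-keyed (rev 14, R4-θ) to the Theta pair; this accepted
    -- statement keeps the rev-13 margin pair, so the rev-13 chain (tree theorem) is applied instead.
    (KolyvaginRankRigidity.kolyvaginRankRigidityAtTwo_closes_rev13 hV1 hV2 hR hIn hT hf h0 hGZK hMod hHLT hEnt)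

/-- **S3's residual 19220 from KRR2's rev-13 item list BY NAME** (same composition).
[cite: Kolyvagin1991MathAnn, §2] [cite: WZhang2014, Thm. 1.1 (shape at p ≥ 5)] -/
theorem rankOneTwoConverse_of_kolyvaginRankRigidityAtTwo_items
    (hV1 : KolyvaginRankRigidityAtTwo.KolyvaginNonvanishingAtTwoFrameStrong)
    (hV2 : KolyvaginRankRigidityAtTwo.KolyvaginCorankLowerBoundAtTwoMargin)
    (hR : KolyvaginRankRigidityAtTwo.OffHabitatNonSurjTwoConverse)
    (hIn : KolyvaginRankRigidityAtTwo.PrintedInputsRankOneAtTwo)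
    (hT : KolyvaginRankRigidityAtTwo.NoTwoTorsionOverK)
    (hf : KolyvaginRankRigidityAtTwo.BFHTwistSupply)
    (h0 : KolyvaginRankRigidityAtTwo.SimpleZeroTwistSplitAtTwoOfBFH)
    (hGZK : KolyvaginRankRigidityAtTwo.MultPublishedInputsAtTwo)
    (hMod : KolyvaginRankRigidityAtTwo.NewformOfEllipticCurve)
    (hHLT : KolyvaginRankRigidityAtTwo.HoffsteinLuoNonvanishingTwist)
    (hEnt : KolyvaginRankRigidityAtTwo.EntireLFunctionRat) :
    Summit.BirchSwinnertonDyer.BirchSwinnertonDyer.Theses.TwoAdicConverse.RankOneTwoConverse :=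
  rankOneTwoConverse_of_nonCMTwoConverse
    -- (buildfix 2026-08-28) KRR2's `closes` was re-keyed (rev 14, R4-θ) to the Theta pair; this accepted
    -- statement keeps the rev-13 margin pair, so the rev-13 chain (tree theorem) is applied instead.
    (KolyvaginRankRigidity.kolyvaginRankRigidityAtTwo_closes_rev13 hV1 hV2 hR hIn hT hf h0 hGZK hMod hHLT hEnt)

end Summit.BirchSwinnertonDyer.BirchSwinnertonDyer.Theorems.TwoAdicOffHabitat
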